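import Summits.QuantumAdvantage.QuantumAdvantage.Theorems.SteerDialWindow

/-!
# SteerDial (7/7): SteerDialItems

§N — the typed intermediate «AlgSpread3» (item 30970 `SpreadDial.AlgSpread3`): necessity `algSpread3_of_spreadLoss3`
(one steered foreign ring realises any algebraic test), `algSpread3_of_ringHard`, domination
`polyLoss3_of_algSpread3`; and §I — the route items BY NAME: `levelCover3 : SpreadDial.LevelCover3` (closes 30971),
`coverSplitGlue3 : SpreadDial.CoverSplitGlue3` (closes 30911), `coverLift3_iff_pieces`, the order `SpreadLoss3 →
AlgSpread3 → PolyLoss3`, `contentCover3`.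

Part 7 of 7 of the prover-side twin of the workshop node «SteerDial» (route `SpreadDial`, node on 29065 `CoverLift3`;
lineage decomp-qadv-lens-5, generation 7).  Content verbatim from the monolithic twin `tree/SpreadDialSteer.lean`
(sha256 5f501baf…, farm rc0 · 0 err · 0 warn · 0 sorry; axioms `propext`/`Classical.choice`/`Quot.sound` for every theorem),
cut at section boundaries to meet the 400-line rule.  No `def … : Prop`, no `instance`, no `notation`.
-/

set_option linter.style.longLine false
set_option linter.dupNamespace false

namespace Summit.QuantumAdvantage.QuantumAdvantage.Theorems.SteerDial

open Finset
open Literature.Computability.QuantumComplexity Literature.Computability.MetaComplexity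
open Literature.Computability.QuantumComplexity.RingHLF
open Summit.QuantumAdvantage.AdviceFreeQNC0
open Summit.QuantumAdvantage.QuantumAdvantage.Theses

/-! ## §N  The node: the algebraic-spread pieces, the deciding theorem, the order of the pieces -/

section Node

/-! «AlgSpread3» (the typed intermediate of the node; its text is INLINED in every statement of this section):
`∃ η > 0, ∃ k, ∀ c, ∃ n₀, ∀ n ≥ n₀, ∀ P (deg ≤ (log₂ n)^c), ∀ ψ ∈ lowDeg ((log₂ n)^c), #{ψ = 1} ≥ (1-η)·2^n →
#({ψ = 1} ∩ Loss P) ≥ 2^n / n^k`. -/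

/-! ### Necessity of the new intermediate: `SpreadLoss3 → AlgSpread3` (one steered foreign ring realises any algebraic test) -/

/-- The odd test pattern `0 1 1 … 1` of length `n`. -/
def oddPat (n : ℕ) : Fin n → Bool := fun i => decide (i.val ≠ 0)

/-- SteerDial helper `reflBit_oddPat` (lens-5 g7 SteerDial twin; see the enclosing section docstring). -/
theorem reflBit_oddPat {n : ℕ} (hn : 1 ≤ n) : reflBit (List.ofFn (oddPat n)) = true := by
  rw [reflBit_ofFn_iff]
  have h : (univ.filter fun i : Fin n => oddPat n i = false) = {⟨0, by omega⟩} := by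
    ext i
    simp only [oddPat, Finset.mem_filter, Finset.mem_univ, true_and, Finset.mem_singleton, decide_eq_false_iff_not,
      not_not, Fin.ext_iff]
  rw [h, Finset.card_singleton]
  exact odd_one

/-- For an odd pattern the relation is ONE parity constraint `⟨v⋆, z⟩ = σ`. -/
theorem rel_odd_iff {n : ℕ} (hn : 3 ≤ n) (x : Fin n → Bool) (hodd : reflBit (List.ofFn x) = true) (z : Fin n → Bool) :
    RingHLF.Rel x z ↔ dot2 (kernelVec x (fixVec (sigmaSum (List.ofFn x)))) z =
      signBit x (kernelVec x (fixVec (sigmaSum (List.ofFn x)))) := by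
  constructor
  · intro h
    exact h _ ((kernel_odd hn x hodd _).2 (Or.inr rfl))
  · intro h v hv
    rcases (kernel_odd hn x hodd v).1 hv with rfl | rfl
    · simp [dot2, signBit, edgesIn, wtAnd]
    · exact h

/-- SteerDial helper `dot2_single` (lens-5 g7 SteerDial twin; see the enclosing section docstring). -/
theorem dot2_single {n : ℕ} (v : Fin n → Bool) (i₀ : Fin n) (hi : v i₀ = true) :
    dot2 v (fun i => decide (i = i₀)) = 1 := by
  unfold dot2
  have h : (univ.filter fun b : Fin n => v b = true ∧ decide (b = i₀) = true) = {i₀} := by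
    ext b
    simp only [Finset.mem_filter, Finset.mem_univ, true_and, Finset.mem_singleton, decide_eq_true_eq]
    constructor
    · exact fun h => h.2
    · intro h; subst h; exact ⟨hi, rfl⟩
  rw [h, Finset.card_singleton]

/-- SteerDial helper `dot2_zero_right` (lens-5 g7 SteerDial twin; see the enclosing section docstring). -/
theorem dot2_zero_right {n : ℕ} (v : Fin n → Bool) : dot2 v (fun _ => false) = 0 := by
  simp [dot2]

/-- **Necessity: `SpreadLoss3 → AlgSpread3`.**  One foreign ring with the odd input `0 1 … 1` and the answer
`Q(y) := z⁰` if `ψ(y) = 1`, `z¹` otherwise (`z⁰` valid, `z¹` invalid, degree `2·deg ψ`) wins exactly on `{ψ = 1}`; apply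
SpreadLoss3 with `m = 1` at exponent `c + 1`. -/
theorem algSpread3_of_spreadLoss3 (h : SpreadDial.SpreadLoss3) :
    (∃ η : ℝ, 0 < η ∧ ∃ k : ℕ, ∀ c : ℕ, ∃ n₀ : ℕ, ∀ n ≥ n₀, ∀ P : Fin n → Smolensky.CubeFn (ZMod 3) n,
      (∀ i, P i ∈ Smolensky.lowDeg (ZMod 3) n ((Nat.log 2 n) ^ c)) →
      ∀ ψ : Smolensky.CubeFn (ZMod 3) n, ψ ∈ Smolensky.lowDeg (ZMod 3) n ((Nat.log 2 n) ^ c) →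
        (1 - η) * (2 : ℝ) ^ n ≤ ((univ.filter fun y : Fin n → Bool => ψ y = 1).card : ℝ) →
        1 / (n : ℝ) ^ k * (2 : ℝ) ^ n ≤
          ((univ.filter fun y : Fin n → Bool => ψ y = 1 ∧ ¬ RingHLF.Rel y (fun i => decide (P i y = 1))).card : ℝ)) := by
  obtain ⟨η, hη, k, hk⟩ := h
  refine ⟨η, hη, k, fun c => ?_⟩
  obtain ⟨n₀, hn₀⟩ := hk (c + 1)
  refine ⟨max n₀ 4, fun n hn P hP ψ hψ hdense => ?_⟩
  have hn₀' : n₀ ≤ n := le_trans (le_max_left _ _) hn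
  have hn4 : 4 ≤ n := le_trans (le_max_right _ _) hn
  have hn3 : 3 ≤ n := by omega
  -- degree bookkeeping: `(log n)^c ≤ (log n)^(c+1)` and `2 (log n)^c ≤ (log n)^(c+1)`
  have hL2 : 2 ≤ Nat.log 2 n := Nat.le_log_of_pow_le (by norm_num) (by omega)
  have hdeg1 : (Nat.log 2 n) ^ c ≤ (Nat.log 2 n) ^ (c + 1) := by
    rw [pow_succ]; exact Nat.le_mul_of_pos_right _ (by omega)
  have hdeg2 : 2 * (Nat.log 2 n) ^ c ≤ (Nat.log 2 n) ^ (c + 1) := by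
    rw [pow_succ, mul_comm]; exact Nat.mul_le_mul_left _ hL2
  -- the foreign ring: odd input, kernel `{0, v⋆}`, one valid and one invalid answer
  set w₁ : Fin n → Bool := oddPat n with hw₁
  have hodd : reflBit (List.ofFn w₁) = true := reflBit_oddPat (by omega)
  set vs : Fin n → Bool := kernelVec w₁ (fixVec (sigmaSum (List.ofFn w₁))) with hvs
  have hvs0 : vs ≠ fun _ => false := kernelVec_fixVec_ne_zero hn3 w₁ hodd
  obtain ⟨i₀, hi₀⟩ : ∃ i₀, vs i₀ = true := by
    obtain ⟨i₀, hi₀⟩ := Function.ne_iff.mp hvs0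
    exact ⟨i₀, by simpa using hi₀⟩
  set σ := signBit w₁ vs with hσ
  -- z⁰ valid, z¹ invalid
  set z0 : Fin n → Bool := fun i => if σ = 1 then decide (i = i₀) else false with hz0
  set z1 : Fin n → Bool := fun i => if σ = 1 then false else decide (i = i₀) with hz1
  have hσ2 : σ = 0 ∨ σ = 1 := by rw [hσ]; unfold signBit; omega
  have hz0v : RingHLF.Rel w₁ z0 := by
    rw [rel_odd_iff hn3 w₁ hodd, ← hvs, ← hσ]
    rcases hσ2 with h0 | h1
    · rw [h0]; simp only [hz0, h0, zero_ne_one, if_false]; exact dot2_zero_right vs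
    · rw [h1]; simp only [hz0, h1, if_true]; exact dot2_single vs i₀ hi₀
  have hz1v : ¬ RingHLF.Rel w₁ z1 := by
    rw [rel_odd_iff hn3 w₁ hodd, ← hvs, ← hσ]
    rcases hσ2 with h0 | h1
    · rw [h0]; simp only [hz1, h0, zero_ne_one, if_false]; rw [dot2_single vs i₀ hi₀]; exact one_ne_zero
    · rw [h1]; simp only [hz1, h1, if_true]; rw [dot2_zero_right vs]; exact zero_ne_one
  -- the low-degree answer `Q i := z⁰ᵢ·ι + z¹ᵢ·(1-ι)`, `ι = [ψ = 1]`
  set ι : Smolensky.CubeFn (ZMod 3) n := ind (fun y => decide (ψ y = 1)) with hι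
  have hιdeg : ι ∈ Smolensky.lowDeg (ZMod 3) n ((Nat.log 2 n) ^ (c + 1)) :=
    Smolensky.lowDeg_mono hdeg2 (ind_decide_mem_lowDeg hψ)
  let Q : Fin 1 → Fin n → Smolensky.CubeFn (ZMod 3) n := fun _ i =>
    (if z0 i then ι else 0) + (if z1 i then 1 - ι else 0)
  have hQdeg : ∀ t i, Q t i ∈ Smolensky.lowDeg (ZMod 3) n ((Nat.log 2 n) ^ (c + 1)) := by
    intro t i
    refine Submodule.add_mem _ ?_ ?_
    · split_ifs
      · exact hιdeg
      · exact Submodule.zero_mem _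
    · split_ifs
      · exact Submodule.sub_mem _ (one_mem_lowDeg _) hιdeg
      · exact Submodule.zero_mem _
  have hQval : ∀ t y, (fun i => decide (Q t i y = 1)) = if ψ y = 1 then z0 else z1 := by
    intro t y
    funext i
    have hιy : ι y = if ψ y = 1 then 1 else 0 := by simp [hι, ind]
    simp only [Q, Pi.add_apply, ite_apply, Pi.sub_apply, Pi.one_apply, Pi.zero_apply]
    by_cases hψy : ψ y = 1
    · rw [if_pos hψy] at hιy
      rw [hιy, if_pos hψy]
      cases z0 i <;> cases z1 i <;> decide
    · rw [if_neg hψy] at hιy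
      rw [hιy, if_neg hψy]
      cases z0 i <;> cases z1 i <;> decide
  have hWin : ∀ y, (∀ t : Fin 1, RingHLF.Rel ((fun _ => w₁) t) (fun i => decide (Q t i y = 1))) ↔ ψ y = 1 := by
    intro y
    constructor
    · intro hall
      have h0 := hall 0
      rw [hQval 0 y] at h0
      by_contra hne
      rw [if_neg hne] at h0
      exact hz1v h0
    · intro hy t
      rw [hQval t y, if_pos hy]
      exact hz0v
  -- apply SpreadLoss3 with m = 1
  have hm : 1 ≤ n ^ k := Nat.one_le_pow _ _ (by omega)
  have hmain := hn₀ n hn₀' P (fun i => Smolensky.lowDeg_mono hdeg1 (hP i)) 1 hm (fun _ => w₁) Q hQdeg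
  have hset1 : (univ.filter fun y : Fin n → Bool =>
      ∀ t : Fin 1, RingHLF.Rel ((fun _ => w₁) t) (fun i => decide (Q t i y = 1))) =
      univ.filter fun y : Fin n → Bool => ψ y = 1 := filter_congr fun y _ => hWin y
  have hset2 : (univ.filter fun y : Fin n → Bool =>
      (∀ t : Fin 1, RingHLF.Rel ((fun _ => w₁) t) (fun i => decide (Q t i y = 1))) ∧
        ¬ RingHLF.Rel y (fun i => decide (P i y = 1))) =
      univ.filter fun y : Fin n → Bool => ψ y = 1 ∧ ¬ RingHLF.Rel y (fun i => decide (P i y = 1)) :=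
    filter_congr fun y _ => by rw [hWin y]
  rw [hset1, hset2] at hmain
  exact hmain hdense

/-- **AlgSpread3 dominates the base 26123**: test `ψ := 1` (degree 0, density 1). So the test-family dial is LINEARLY
ORDERED by proved implications: `T = RingHardOdd 3 ⟹ SpreadLoss3 (29064) ⟹ «AlgSpread3» ⟹ PolyLoss3 (26123)`. -/
theorem polyLoss3_of_algSpread3
    (h : (∃ η : ℝ, 0 < η ∧ ∃ k : ℕ, ∀ c : ℕ, ∃ n₀ : ℕ, ∀ n ≥ n₀, ∀ P : Fin n → Smolensky.CubeFn (ZMod 3) n,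
      (∀ i, P i ∈ Smolensky.lowDeg (ZMod 3) n ((Nat.log 2 n) ^ c)) →
      ∀ ψ : Smolensky.CubeFn (ZMod 3) n, ψ ∈ Smolensky.lowDeg (ZMod 3) n ((Nat.log 2 n) ^ c) →
        (1 - η) * (2 : ℝ) ^ n ≤ ((univ.filter fun y : Fin n → Bool => ψ y = 1).card : ℝ) →
        1 / (n : ℝ) ^ k * (2 : ℝ) ^ n ≤
          ((univ.filter fun y : Fin n → Bool => ψ y = 1 ∧ ¬ RingHLF.Rel y (fun i => decide (P i y = 1))).card : ℝ))) :
    SpreadDial.PolyLoss3 := by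
  obtain ⟨η, hη, k, hk⟩ := h
  refine ⟨k, fun c => ?_⟩
  obtain ⟨n₀, hn₀⟩ := hk c
  refine ⟨n₀, fun n hn P hP => ?_⟩
  have h1 : (1 : Smolensky.CubeFn (ZMod 3) n) ∈ Smolensky.lowDeg (ZMod 3) n ((Nat.log 2 n) ^ c) := one_mem_lowDeg _
  have hdense : (1 - η) * (2 : ℝ) ^ n ≤ ((univ.filter fun y : Fin n → Bool => (1 : Smolensky.CubeFn (ZMod 3) n) y = 1).card : ℝ) := by
    have hall : (univ.filter fun y : Fin n → Bool => (1 : Smolensky.CubeFn (ZMod 3) n) y = 1) = univ :=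
      filter_true_of_mem fun y _ => rfl
    rw [hall, Finset.card_univ, Fintype.card_fun, Fintype.card_bool, Fintype.card_fin]
    push_cast
    have : (0 : ℝ) ≤ η * (2 : ℝ) ^ n := by positivity
    linarith
  have hmain := hn₀ n hn P hP 1 h1 hdense
  have hset : (univ.filter fun y : Fin n → Bool =>
      (1 : Smolensky.CubeFn (ZMod 3) n) y = 1 ∧ ¬ RingHLF.Rel y (fun i => decide (P i y = 1))) =
      univ.filter fun y : Fin n → Bool => ¬ RingHLF.Rel y (fun i => decide (P i y = 1)) :=
    filter_congr fun y _ => by simp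
  rw [hset] at hmain
  have hsum := card_win_add_card_loss (fun y : Fin n → Bool => RingHLF.Rel y (fun i => decide (P i y = 1)))
  have e : (1 - 1 / (n : ℝ) ^ k) * (2 : ℝ) ^ n = (2 : ℝ) ^ n - 1 / (n : ℝ) ^ k * (2 : ℝ) ^ n := by ring
  rw [e]
  linarith

/-- Necessity for `RingHard 3`: under a CONSTANT absolute loss `1-θ` no test of density `≥ 1-(1-θ)/2` hides the losses. -/
theorem algSpread3_of_ringHard (h : RingHard 3) :
    (∃ η : ℝ, 0 < η ∧ ∃ k : ℕ, ∀ c : ℕ, ∃ n₀ : ℕ, ∀ n ≥ n₀, ∀ P : Fin n → Smolensky.CubeFn (ZMod 3) n,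
      (∀ i, P i ∈ Smolensky.lowDeg (ZMod 3) n ((Nat.log 2 n) ^ c)) →
      ∀ ψ : Smolensky.CubeFn (ZMod 3) n, ψ ∈ Smolensky.lowDeg (ZMod 3) n ((Nat.log 2 n) ^ c) →
        (1 - η) * (2 : ℝ) ^ n ≤ ((univ.filter fun y : Fin n → Bool => ψ y = 1).card : ℝ) →
        1 / (n : ℝ) ^ k * (2 : ℝ) ^ n ≤
          ((univ.filter fun y : Fin n → Bool => ψ y = 1 ∧ ¬ RingHLF.Rel y (fun i => decide (P i y = 1))).card : ℝ)) := by
  classical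
  obtain ⟨θ, hθ, hc⟩ := h
  refine ⟨(1 - θ) / 2, by linarith, 1, fun c => ?_⟩
  obtain ⟨n₀, hn₀⟩ := hc c
  obtain ⟨N, hN⟩ := exists_nat_gt (2 / (1 - θ))
  refine ⟨max n₀ (max N 1), fun n hn P hP ψ _ hdense => ?_⟩
  have hnn₀ : n₀ ≤ n := le_of_max_le_left hn
  have hnN : N ≤ n := le_of_max_le_left (le_of_max_le_right hn)
  have hn1 : 1 ≤ n := le_of_max_le_right (le_of_max_le_right hn)
  have hpos : 0 < 1 - θ := by linarith
  have hwin := hn₀ n hnn₀ P hP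
  have hsplit := Finset.card_filter_add_card_filter_not
    (s := univ.filter fun y : Fin n → Bool => ψ y = 1) (fun y => RingHLF.Rel y (fun i => decide (P i y = 1)))
  rw [Finset.filter_filter, Finset.filter_filter] at hsplit
  have hle : (univ.filter fun y : Fin n → Bool => ψ y = 1 ∧ RingHLF.Rel y (fun i => decide (P i y = 1))).card ≤
      (univ.filter fun y : Fin n → Bool => RingHLF.Rel y (fun i => decide (P i y = 1))).card :=
    card_le_card fun y hy => by
      simp only [Finset.mem_filter, Finset.mem_univ, true_and] at hy ⊢
      exact hy.2
  have hnR : (2 : ℝ) / (1 - θ) < n := lt_of_lt_of_le hN (by exact_mod_cast hnN)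
  have hinv : 1 / (n : ℝ) ^ 1 ≤ (1 - θ) / 2 := by
    rw [pow_one, div_le_div_iff₀ (by exact_mod_cast (show 0 < n by omega)) (by norm_num)]
    have := (div_lt_iff₀ hpos).mp hnR
    linarith
  have hsplitR : ((univ.filter fun y : Fin n → Bool => ψ y = 1 ∧ RingHLF.Rel y (fun i => decide (P i y = 1))).card : ℝ) +
      ((univ.filter fun y : Fin n → Bool => ψ y = 1 ∧ ¬ RingHLF.Rel y (fun i => decide (P i y = 1))).card : ℝ) =
      ((univ.filter fun y : Fin n → Bool => ψ y = 1).card : ℝ) := by exact_mod_cast hsplit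
  have hleR : ((univ.filter fun y : Fin n → Bool => ψ y = 1 ∧ RingHLF.Rel y (fun i => decide (P i y = 1))).card : ℝ) ≤
      ((univ.filter fun y : Fin n → Bool => RingHLF.Rel y (fun i => decide (P i y = 1))).card : ℝ) := by exact_mod_cast hle
  have h2n : (0 : ℝ) < (2 : ℝ) ^ n := by positivity
  calc 1 / (n : ℝ) ^ 1 * (2 : ℝ) ^ n ≤ (1 - θ) / 2 * (2 : ℝ) ^ n := mul_le_mul_of_nonneg_right hinv h2n.le
    _ ≤ _ := by nlinarith

/-- Necessity for T: `RingHardOdd 3 → AlgSpread3` (give away the even class: tree `ringHardOfOdd`). -/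
theorem algSpread3_of_ringHardOdd (h : RingHardOdd 3) :
    (∃ η : ℝ, 0 < η ∧ ∃ k : ℕ, ∀ c : ℕ, ∃ n₀ : ℕ, ∀ n ≥ n₀, ∀ P : Fin n → Smolensky.CubeFn (ZMod 3) n,
      (∀ i, P i ∈ Smolensky.lowDeg (ZMod 3) n ((Nat.log 2 n) ^ c)) →
      ∀ ψ : Smolensky.CubeFn (ZMod 3) n, ψ ∈ Smolensky.lowDeg (ZMod 3) n ((Nat.log 2 n) ^ c) →
        (1 - η) * (2 : ℝ) ^ n ≤ ((univ.filter fun y : Fin n → Bool => ψ y = 1).card : ℝ) →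
        1 / (n : ℝ) ^ k * (2 : ℝ) ^ n ≤
          ((univ.filter fun y : Fin n → Bool => ψ y = 1 ∧ ¬ RingHLF.Rel y (fun i => decide (P i y = 1))).card : ℝ)) :=
  algSpread3_of_ringHard (ringHardOfOdd 3 h)

end Node

/-! ## §I  The route's items BY NAME (tree `Theses/SpreadDial.lean` rev 2: 30909 `AlgCover3`, 30910 `PureCover3`,
30911 `CoverSplitGlue3`, 30970 `AlgSpread3`, 30971 `LevelCover3`) — closers and the order of the pieces -/

section Items

/-- **Item 30971 `LevelCover3` (BC5 witness of 30909) — PROVED**: every single Hamming level class mod 3 carries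
`≥ 2^n/n^k` losing inputs of every polylog-degree strategy, granted `PolyLoss3` (by `levelSpread3_of_polyLoss3`). -/
theorem levelCover3 : SpreadDial.LevelCover3 := fun hP => levelWitness3 hP

/-- **Item 30911 `CoverSplitGlue3` — PROVED** (the split of 29065 is exact in this direction by composition). -/
theorem coverSplitGlue3 : SpreadDial.CoverSplitGlue3 := fun hA hR hP => hR hP (hA hP)

/-- The split is EXACT: `CoverLift3 ↔ AlgCover3 ∧ PureCover3` (29065 ⟺ 30909 ∧ 30910). -/
theorem coverLift3_iff_pieces : SpreadDial.CoverLift3 ↔ (SpreadDial.AlgCover3 ∧ SpreadDial.PureCover3) :=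
  ⟨fun h => ⟨fun hP => algSpread3_of_spreadLoss3 (h hP), fun hP _ => h hP⟩, fun h hP => h.2 hP (h.1 hP)⟩

/-- Order of the pieces, by name: `SpreadLoss3 (29064) → AlgSpread3 (30970)`. -/
theorem algSpread3_of_spreadLoss3_item : SpreadDial.SpreadLoss3 → SpreadDial.AlgSpread3 :=
  fun h => algSpread3_of_spreadLoss3 h

/-- Order of the pieces, by name: `AlgSpread3 (30970) → PolyLoss3 (26123)` (take `ψ := 1`). -/
theorem polyLoss3_of_algSpread3_item : SpreadDial.AlgSpread3 → SpreadDial.PolyLoss3 :=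
  fun h => polyLoss3_of_algSpread3 h

/-- `AlgSpread3 (30970) ↔ PolyLoss3 (26123) ∧ AlgCover3 (30909)`. -/
theorem algSpread3_iff_polyLoss3_and_algCover3 :
    SpreadDial.AlgSpread3 ↔ (SpreadDial.PolyLoss3 ∧ SpreadDial.AlgCover3) :=
  ⟨fun h => ⟨polyLoss3_of_algSpread3 h, fun _ => h⟩, fun h => h.2 h.1⟩

/-- Necessity for the summit's ring engine, by name: `RingHard 3 → AlgSpread3 (30970)`. -/
theorem algSpread3_of_ringHard_item : RingHard 3 → SpreadDial.AlgSpread3 := fun h => algSpread3_of_ringHard h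

/-- **PARTIAL RANGE of item 30909 `AlgCover3`, contiguous 6-juntas**: granted `PolyLoss3`, for all large `n`, EVERY
window-content cylinder `{x : (rot_s x)_{n+6+j} = (w₀)_j, j<6}` of `C_{n+12}` (every `w₀`, every `s`) carries
`≥ 2^{n+12}/(n+12)^k` losing inputs — restated over tree names only. -/
theorem contentCover3 : SpreadDial.PolyLoss3 →
    ∃ k : ℕ, ∀ c : ℕ, ∃ n₀ : ℕ, ∀ n ≥ n₀, ∀ P : Fin (n + 12) → Smolensky.CubeFn (ZMod 3) (n + 12),
      (∀ b, P b ∈ Smolensky.lowDeg (ZMod 3) (n + 12) ((Nat.log 2 (n + 12)) ^ c)) →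
        ∀ w₀ : Fin 6 → Bool, ∀ s : ℕ,
          1 / ((n + 12 : ℕ) : ℝ) ^ k * (2 : ℝ) ^ (n + 12) ≤
            ((univ.filter fun x : Fin (n + 12) → Bool =>
              (∀ j : Fin 6, rot s x (Fin.natAdd (n + 6) j) = w₀ j) ∧
                ¬ RingHLF.Rel x (fun b => decide (P b x = 1))).card : ℝ) :=
  fun hP => contentCylinderLoss3_of_polyLoss3 hP

end Items

end Summit.QuantumAdvantage.QuantumAdvantage.Theorems.SteerDial
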